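import Summits.AtomisticToContinuum.HydrodynamicLimit.Theorems.OneFlightGossipEngineClampedCurrentsDockCutoff
import Literature.Analysis.FunctionSpaces.TorusSpaceTime
import Literature.Analysis.FluidPDE.FractionalNSPrescribedEnergyIterationLimit
import HarnessLib

/-!
# The kinetic instance KC1 — class-member and slab toolkit (periphery of stub `stub_kineticInstance`,
# line `IdeatorTwoSketch`, crux `ClampedCurrentsDock`, stmt-AtomisticToContinuum-14680)

Support file (`--supports stmt-AtomisticToContinuum-14680`), imported by
`OneFlightGossipEngineClampedCurrentsDockKineticInstance.lean` (the registered stub KC1 of the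
lead's skeleton `Cruxes/ClampedCurrentsDock/Lines/IdeatorTwoSketch.lean`, §1c). Deterministic facts
about the class member of the kinetic window LD generated by the Euler cancellation S8,
`F(v) = Σ A_{jk} w_j w_k + (b·w) G(|w|²)`, `w = v − u`, under the local Maxwellian `M_{1,u,θ}`:

* §1 Gaussian moments (on top of the ClassTruncation toolkit
  `KineticCurrentsWindowLDUniformSketch.ClassTruncation`): the TRACELESS quadratic part
  `Q = Σ A_{jk} w_j w_k`, `tr A = 0`, is orthogonal to `1, v_l, ‖v‖²`
  (`quad_orth`: `∫ Q M = θ tr A E[ξ₀²] = 0`, odd first moments, `∫ Q‖ξ‖² dγ = θ tr A E[ξ₀²‖ξ‖²] = 0`,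
  transported to the Maxwellian variable for functionals of quadratic growth,
  `maxwellian_orth_of_gauss_orth'`); sums of Maxwellian-orthogonal functionals of quadratic growth
  stay orthogonal (`orth_add`, split in the reduced Gaussian variable); hence the full member is
  orthogonal as soon as its flux part is (`member_orth`); quadratic growth of `Q` (`quad_growth`);
* §2 slab calculus on `[0,t₁] × 𝕋³` (joint continuity on `ℝ × 𝕋³` from continuity of the
  space–time lift is the tree's `Torus.continuousOn_uncurry_of_continuousOn_stLift`): clamping of the parameter
  (`continuous_clamp`), joint continuity of space derivatives of fields jointly smooth on the CLOSED
  slab (`continuousOn_partialDeriv_slab`, also for the degenerate slab `t₁ = 0`), bounds and positive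
  lower bounds by compactness;
* §3 the algebra of the traceless stress: `θ⁻¹Σ(w_jw_k − δ_{jk}|w|²/3)∂_k u_j = Σ A_{jk} w_j w_k` with
  `A_{jk} = θ⁻¹(∂_k u_j − δ_{jk} div u/3)` traceless (`traceless_form`, `trace_free`).
-/

noncomputable section

namespace Summit.AtomisticToContinuum.HydrodynamicLimit.Theorems.ClampedCurrentsDockKineticInstance

open scoped BigOperators ENNReal Classical Interval
open MeasureTheory Filter Set Topology
open Literature.MathematicalPhysics.KineticTheory Literature.Analysis.FluidPDE Literature.Analysis.FunctionSpaces
open ProbabilityTheory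
open Summit.AtomisticToContinuum.HydrodynamicLimit.Theorems.KineticCurrentsWindowLDUniformSketch.ClassTruncation

/-! ## §1 Gaussian moments: orthogonality of the traceless quadratic part, sums of class functionals -/

/-- `|Σ_{jk} A_{jk} ξ_j ξ_k| ≤ (Σ_{jk} |A_{jk}|) ‖ξ‖²`. [folklore] -/
theorem abs_quad_le (A : Fin 3 → Fin 3 → ℝ) (ξ : V3) :
    |∑ j, ∑ k, A j k * (ξ j * ξ k)| ≤ (∑ j, ∑ k, |A j k|) * ‖ξ‖ ^ 2 := by
  rw [Finset.sum_mul]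
  refine (Finset.abs_sum_le_sum_abs _ _).trans (Finset.sum_le_sum fun j _ => ?_)
  rw [Finset.sum_mul]
  refine (Finset.abs_sum_le_sum_abs _ _).trans (Finset.sum_le_sum fun k _ => ?_)
  rw [abs_mul]
  refine mul_le_mul_of_nonneg_left ?_ (abs_nonneg _)
  have hj : |ξ j| ≤ ‖ξ‖ := by simpa only [Real.norm_eq_abs] using PiLp.norm_apply_le ξ j
  have hk : |ξ k| ≤ ‖ξ‖ := by simpa only [Real.norm_eq_abs] using PiLp.norm_apply_le ξ k
  rw [abs_mul, sq]
  exact mul_le_mul hj hk (abs_nonneg _) (norm_nonneg _)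

/-- Quadratic growth of the quadratic part of a class member:
`|Σ A_{jk} w_j w_k| ≤ (Σ|A_{jk}|)(2 + 2‖u‖²)(1 + ‖v‖²)`, `w = v − u`. [folklore] -/
theorem quad_growth (u : V3) (A : Fin 3 → Fin 3 → ℝ) (v : V3) :
    |∑ j, ∑ k, A j k * ((v - u) j * (v - u) k)| ≤
      (∑ j, ∑ k, |A j k|) * (2 + 2 * ‖u‖ ^ 2) * (1 + ‖v‖ ^ 2) := by
  refine (abs_quad_le A (v - u)).trans ?_
  have hS : 0 ≤ ∑ j, ∑ k, |A j k| :=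
    Finset.sum_nonneg fun j _ => Finset.sum_nonneg fun k _ => abs_nonneg _
  have h0 : ‖v - u‖ ≤ ‖v‖ + ‖u‖ := norm_sub_le v u
  have h1 : ‖v - u‖ ^ 2 ≤ (‖v‖ + ‖u‖) ^ 2 := pow_le_pow_left₀ (norm_nonneg _) h0 2
  have h2 : ‖v - u‖ ^ 2 ≤ (2 + 2 * ‖u‖ ^ 2) * (1 + ‖v‖ ^ 2) := by
    nlinarith [sq_nonneg (‖v‖ - ‖u‖), mul_nonneg (sq_nonneg ‖u‖) (sq_nonneg ‖v‖)]
  rw [mul_assoc]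
  exact mul_le_mul_of_nonneg_left h2 hS

/-- The quadratic part in the reduced variable: `Σ A_{jk} w_j w_k = θ Σ A_{jk} ξ_j ξ_k` for
`v = u + √θ ξ`. [folklore] -/
theorem quad_shift {θ : ℝ} (hθ : 0 ≤ θ) (u : V3) (A : Fin 3 → Fin 3 → ℝ) (ξ : V3) :
    (∑ j, ∑ k, A j k * ((u + Real.sqrt θ • ξ - u) j * (u + Real.sqrt θ • ξ - u) k)) =
      θ * ∑ j, ∑ k, A j k * (ξ j * ξ k) := by
  simp only [add_sub_cancel_left, PiLp.smul_apply, smul_eq_mul]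
  rw [Finset.mul_sum]
  refine Finset.sum_congr rfl fun j _ => ?_
  rw [Finset.mul_sum]
  refine Finset.sum_congr rfl fun k _ => ?_
  linear_combination (A j k * (ξ j * ξ k)) * Real.mul_self_sqrt hθ

/-- A quadratic-growth bound in `v` is a quadratic-growth bound in the reduced variable:
`|Φ(u + √θ ξ)| ≤ K(1 + 2‖u‖² + 2θ)(1 + ‖ξ‖²)`. [folklore] -/
theorem growth_shift {Φ : V3 → ℝ} {K : ℝ} (hK : ∀ v, |Φ v| ≤ K * (1 + ‖v‖ ^ 2)) {θ : ℝ}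
    (hθ : 0 ≤ θ) (u ξ : V3) :
    |Φ (u + Real.sqrt θ • ξ)| ≤ K * (1 + 2 * ‖u‖ ^ 2 + 2 * θ) * (1 + ‖ξ‖ ^ 2) := by
  have hK0 : 0 ≤ K := by
    have h := (abs_nonneg _).trans (hK 0)
    rw [norm_zero] at h
    linarith
  refine (hK _).trans ?_
  have h1 := norm_shift_sq_le hθ u ξ
  have h2 : 1 + ‖u + Real.sqrt θ • ξ‖ ^ 2 ≤ (1 + 2 * ‖u‖ ^ 2 + 2 * θ) * (1 + ‖ξ‖ ^ 2) := by
    nlinarith [sq_nonneg ‖u‖, sq_nonneg ‖ξ‖, mul_nonneg hθ (sq_nonneg ‖ξ‖),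
      mul_nonneg (sq_nonneg ‖u‖) (sq_nonneg ‖ξ‖)]
  rw [mul_assoc]
  exact mul_le_mul_of_nonneg_left h2 hK0

-- adapted from Summits/.../OneFlightGossipEngineKineticCurrentsWindowLDUniformClassTruncationReduced.lean
-- (`maxwellian_orth_of_gauss_orth`, bounded functionals), here for functionals of quadratic growth
/-- From reduced orthogonality to `1, ξ_j, ‖ξ‖²` back to Maxwellian orthogonality to `1, v_j, ‖v‖²`,
for a continuous functional of quadratic growth in the reduced variable. [folklore] -/
theorem maxwellian_orth_of_gauss_orth' {Φ : V3 → ℝ} (hΦ : Continuous Φ) {θ : ℝ} (hθ : 0 < θ)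
    (u : V3) {K : ℝ} (hK : ∀ ξ, |Φ (u + Real.sqrt θ • ξ)| ≤ K * (1 + ‖ξ‖ ^ 2))
    (h0 : ∫ ξ, Φ (u + Real.sqrt θ • ξ) ∂stdGaussian V3 = 0)
    (h1 : ∀ j, ∫ ξ, Φ (u + Real.sqrt θ • ξ) * ξ j ∂stdGaussian V3 = 0)
    (h2 : ∫ ξ, Φ (u + Real.sqrt θ • ξ) * ‖ξ‖ ^ 2 ∂stdGaussian V3 = 0) :
    (∫ v, Φ v * localMaxwellian 1 θ u v = 0) ∧
      (∀ j, ∫ v, Φ v * v j * localMaxwellian 1 θ u v = 0) ∧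
      ∫ v, Φ v * ‖v‖ ^ 2 * localMaxwellian 1 θ u v = 0 := by
  obtain ⟨hi0, hi1, hi2⟩ := integrable_of_le_lin (h := fun ξ => Φ (u + Real.sqrt θ • ξ))
    (by fun_prop) hK
  refine ⟨by rwa [integral_mul_localMaxwellian_shift hθ], fun j => ?_, ?_⟩
  · rw [integral_mul_localMaxwellian_shift hθ u (fun v => Φ v * v j)]
    simp only [PiLp.add_apply, PiLp.smul_apply, smul_eq_mul]
    have e : (fun ξ : V3 => Φ (u + Real.sqrt θ • ξ) * (u j + Real.sqrt θ * ξ j)) = fun ξ =>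
        u j * Φ (u + Real.sqrt θ • ξ) + Real.sqrt θ * (Φ (u + Real.sqrt θ • ξ) * ξ j) := by
      funext ξ; ring
    rw [e, integral_add (hi0.const_mul _) ((hi1 j).const_mul _), integral_const_mul,
      integral_const_mul, h0, h1 j, mul_zero, mul_zero, add_zero]
  · rw [integral_mul_localMaxwellian_shift hθ u (fun v => Φ v * ‖v‖ ^ 2)]
    simp only [norm_shift_sq_eq hθ.le]
    have e : (fun ξ : V3 => Φ (u + Real.sqrt θ • ξ) *
        (‖u‖ ^ 2 + 2 * Real.sqrt θ * (∑ j, u j * ξ j) + θ * ‖ξ‖ ^ 2)) = fun ξ =>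
        ‖u‖ ^ 2 * Φ (u + Real.sqrt θ • ξ) +
          2 * Real.sqrt θ * (∑ j, u j * (Φ (u + Real.sqrt θ • ξ) * ξ j)) +
          θ * (Φ (u + Real.sqrt θ • ξ) * ‖ξ‖ ^ 2) := by
      funext ξ; simp only [Fin.sum_univ_three]; ring
    have his : Integrable (fun ξ : V3 => ∑ j, u j * (Φ (u + Real.sqrt θ • ξ) * ξ j))
        (stdGaussian V3) := integrable_finsetSum _ fun j _ => (hi1 j).const_mul _
    have hA : Integrable (fun ξ : V3 => ‖u‖ ^ 2 * Φ (u + Real.sqrt θ • ξ) +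
        2 * Real.sqrt θ * (∑ j, u j * (Φ (u + Real.sqrt θ • ξ) * ξ j))) (stdGaussian V3) :=
      (hi0.const_mul _).add (his.const_mul _)
    rw [e, integral_add hA (hi2.const_mul _), integral_add (hi0.const_mul _) (his.const_mul _),
      integral_const_mul, integral_const_mul, integral_const_mul,
      integral_finsetSum _ fun j _ => (hi1 j).const_mul _]
    simp [integral_const_mul, h0, h1, h2]

/-- **Orthogonality of the traceless quadratic part.** For `tr A = 0`, the functional
`Q(v) = Σ A_{jk} w_j w_k`, `w = v − u`, is orthogonal to `1, v_l, ‖v‖²` under `M_{1,u,θ}`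
(`∫ Q M = θ tr A E[ξ₀²] = 0`, odd first moments, `∫ Q‖ξ‖² dγ = θ tr A E[ξ₀²‖ξ‖²] = 0`). [folklore] -/
theorem quad_orth {θ : ℝ} (hθ : 0 < θ) (u : V3) {A : Fin 3 → Fin 3 → ℝ} (htr : ∑ j, A j j = 0) :
    (∫ v, (∑ j, ∑ k, A j k * ((v - u) j * (v - u) k)) * localMaxwellian 1 θ u v = 0) ∧
    (∀ l, ∫ v, (∑ j, ∑ k, A j k * ((v - u) j * (v - u) k)) * v l * localMaxwellian 1 θ u v = 0) ∧
    ∫ v, (∑ j, ∑ k, A j k * ((v - u) j * (v - u) k)) * ‖v‖ ^ 2 * localMaxwellian 1 θ u v = 0 := by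
  set Φ : V3 → ℝ := fun v => ∑ j, ∑ k, A j k * ((v - u) j * (v - u) k) with hΦ
  have hΦc : Continuous Φ := by rw [hΦ]; fun_prop
  have hh : ∀ ξ, Φ (u + Real.sqrt θ • ξ) = θ * (∑ j, ∑ k, A j k * (ξ j * ξ k)) * 1 +
      Real.sqrt θ * (∑ j, (0 : V3) j * ξ j) * 0 := fun ξ => by
    rw [hΦ]; dsimp only; rw [quad_shift hθ.le]; simp
  have hS : 0 ≤ ∑ j, ∑ k, |A j k| :=
    Finset.sum_nonneg fun j _ => Finset.sum_nonneg fun k _ => abs_nonneg _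
  have hK : ∀ ξ, |Φ (u + Real.sqrt θ • ξ)| ≤ θ * (∑ j, ∑ k, |A j k|) * (1 + ‖ξ‖ ^ 2) := fun ξ => by
    rw [hΦ]; dsimp only; rw [quad_shift hθ.le, abs_mul, abs_of_pos hθ, mul_assoc]
    refine mul_le_mul_of_nonneg_left ((abs_quad_le A ξ).trans ?_) hθ.le
    exact mul_le_mul_of_nonneg_left (by linarith [sq_nonneg ‖ξ‖]) hS
  obtain ⟨hi0, -, hi2⟩ := integrable_of_le_lin (h := fun ξ => Φ (u + Real.sqrt θ • ξ))
    (by fun_prop) hK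
  refine maxwellian_orth_of_gauss_orth' hΦc hθ u hK ?_ (fun j => ?_) ?_
  · have h := integral_classForm_mul_even (κ := fun _ => (1 : ℝ)) (lam := fun _ => (0 : ℝ))
      (ϖ := fun _ => (1 : ℝ)) hh (by fun_prop) (P := 1)
      (fun s hs => by rw [mul_one, abs_one]; linarith) (by simpa using hi0)
    simp only [mul_one] at h
    rw [h, htr, mul_zero, zero_mul]
  · have h := integral_classForm_mul_coord (κ := fun _ => (1 : ℝ)) (lam := fun _ => (0 : ℝ)) hh
      continuous_const (P := 1) (fun s _ => by rw [abs_one]) continuous_const (Q := 0)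
      (fun s _ => by rw [abs_zero, zero_mul]) j
    rw [h]
    simp
  · have h := integral_classForm_mul_even (κ := fun _ => (1 : ℝ)) (lam := fun _ => (0 : ℝ))
      (ϖ := fun s => s) hh (by fun_prop) (P := 1)
      (fun s hs => by rw [one_mul, abs_of_nonneg hs]; linarith) hi2
    rw [h, htr, mul_zero, zero_mul]

/-- **Sums of Maxwellian-orthogonal functionals.** If `Φ, Ψ` are continuous of quadratic growth,
`W` a continuous weight of quadratic growth, and `ΦW ⊥ M`, `ΨW ⊥ M`, then `(Φ + Ψ)W ⊥ M`
(split in the reduced Gaussian variable, where everything is integrable). [folklore] -/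
theorem orth_add {Φ Ψ W : V3 → ℝ} (hΦ : Continuous Φ) (hΨ : Continuous Ψ) (hW : Continuous W)
    {θ : ℝ} (hθ : 0 < θ) (u : V3) {KΦ KΨ L : ℝ}
    (hKΦ : ∀ v, |Φ v| ≤ KΦ * (1 + ‖v‖ ^ 2)) (hKΨ : ∀ v, |Ψ v| ≤ KΨ * (1 + ‖v‖ ^ 2))
    (hL : ∀ v, |W v| ≤ L * (1 + ‖v‖ ^ 2))
    (h1 : ∫ v, Φ v * W v * localMaxwellian 1 θ u v = 0)
    (h2 : ∫ v, Ψ v * W v * localMaxwellian 1 θ u v = 0) :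
    ∫ v, (Φ v + Ψ v) * W v * localMaxwellian 1 θ u v = 0 := by
  rw [integral_mul_localMaxwellian_shift hθ u (fun v => (Φ v + Ψ v) * W v)]
  rw [integral_mul_localMaxwellian_shift hθ u (fun v => Φ v * W v)] at h1
  rw [integral_mul_localMaxwellian_shift hθ u (fun v => Ψ v * W v)] at h2
  have hone : ∀ ξ : V3, |(1 : ℝ)| ≤ 1 * (1 + ‖ξ‖ ^ 2) := fun ξ => by
    rw [abs_one]; nlinarith [sq_nonneg ‖ξ‖]
  have hi : ∀ {X : V3 → ℝ} {K : ℝ}, Continuous X → (∀ v, |X v| ≤ K * (1 + ‖v‖ ^ 2)) →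
      Integrable (fun ξ => X (u + Real.sqrt θ • ξ) * W (u + Real.sqrt θ • ξ)) (stdGaussian V3) := by
    intro X K hX hKX
    refine integrable_of_le_cube (by fun_prop)
      (K * (1 + 2 * ‖u‖ ^ 2 + 2 * θ) * (L * (1 + 2 * ‖u‖ ^ 2 + 2 * θ)) * 1) fun ξ => ?_
    have h := abs_mul_three_le (growth_shift hKX hθ.le u ξ) (growth_shift hL hθ.le u ξ) (hone ξ)
    rwa [mul_one] at h
  simp only [add_mul]
  rw [integral_add (hi hΦ hKΦ) (hi hΨ hKΨ), h1, h2, add_zero]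

/-- **Orthogonality of the full class member** `F(v) = Σ A_{jk} w_j w_k + (b·w) G(|w|²)`,
`w = v − u`, to `1, v_k, ‖v‖²` under `M_{1,u,θ}`: the traceless quadratic part by `quad_orth`, the
flux part by hypothesis. [folklore] -/
theorem member_orth {θ : ℝ} (hθ : 0 < θ) (u : V3) {A : Fin 3 → Fin 3 → ℝ} (htr : ∑ j, A j j = 0)
    (b : V3) {Gx : ℝ → ℝ} (hG : Continuous Gx) {CF : ℝ}
    (hFl : ∀ v, |(∑ j, b j * (v - u) j) * Gx (‖v - u‖ ^ 2)| ≤ CF * (1 + ‖v‖ ^ 2))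
    (h0 : ∫ v, (∑ j, b j * (v - u) j) * Gx (‖v - u‖ ^ 2) * localMaxwellian 1 θ u v = 0)
    (h1 : ∀ k, ∫ v, (∑ j, b j * (v - u) j) * Gx (‖v - u‖ ^ 2) * v k *
      localMaxwellian 1 θ u v = 0)
    (h2 : ∫ v, (∑ j, b j * (v - u) j) * Gx (‖v - u‖ ^ 2) * ‖v‖ ^ 2 *
      localMaxwellian 1 θ u v = 0) :
    (∫ v, ((∑ j, ∑ k, A j k * ((v - u) j * (v - u) k)) +
        (∑ j, b j * (v - u) j) * Gx (‖v - u‖ ^ 2)) * localMaxwellian 1 θ u v = 0) ∧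
    (∀ k, ∫ v, ((∑ j, ∑ k, A j k * ((v - u) j * (v - u) k)) +
        (∑ j, b j * (v - u) j) * Gx (‖v - u‖ ^ 2)) * v k * localMaxwellian 1 θ u v = 0) ∧
    ∫ v, ((∑ j, ∑ k, A j k * ((v - u) j * (v - u) k)) +
        (∑ j, b j * (v - u) j) * Gx (‖v - u‖ ^ 2)) * ‖v‖ ^ 2 * localMaxwellian 1 θ u v = 0 := by
  obtain ⟨q0, q1, q2⟩ := quad_orth hθ u htr
  have hQc : Continuous fun v : V3 => ∑ j, ∑ k, A j k * ((v - u) j * (v - u) k) := by fun_prop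
  have hFc : Continuous fun v : V3 => (∑ j, b j * (v - u) j) * Gx (‖v - u‖ ^ 2) := by fun_prop
  have hKQ := quad_growth u A
  have hone : ∀ v : V3, |(1 : ℝ)| ≤ 1 * (1 + ‖v‖ ^ 2) := fun v => by
    rw [abs_one]; nlinarith [sq_nonneg ‖v‖]
  have hsq : ∀ v : V3, |‖v‖ ^ 2| ≤ 1 * (1 + ‖v‖ ^ 2) := fun v => by
    rw [abs_of_nonneg (sq_nonneg _)]; nlinarith [sq_nonneg ‖v‖]
  refine ⟨?_, fun k => ?_, ?_⟩
  · have h := orth_add (W := fun _ => (1 : ℝ)) hQc hFc continuous_const hθ u hKQ hFl hone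
      (by simpa only [mul_one] using q0) (by simpa only [mul_one] using h0)
    simpa only [mul_one] using h
  · exact orth_add (W := fun v => v k) hQc hFc (by fun_prop) hθ u hKQ hFl
      (fun v => abs_coord_le' v k) (q1 k) (h1 k)
  · exact orth_add (W := fun v => ‖v‖ ^ 2) hQc hFc (by fun_prop) hθ u hKQ hFl hsq q2 h2

/-! ## §2 Slab calculus: joint continuity on `[0,t₁] × 𝕋³`, clamping, bounds -/

/-- Clamping the parameter: if `uncurry f` is continuous on `[0,t₁] × 𝕋³` and `p : ℝ → [0,t₁]` is
continuous, then `(s, x) ↦ f (p s) x` is continuous on `ℝ × 𝕋³`. [folklore] -/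
theorem continuous_clamp {X : Type*} [TopologicalSpace X] {t₁ : ℝ} {p : ℝ → ℝ} (hp : Continuous p)
    (hpm : ∀ s, p s ∈ Icc 0 t₁) {f : ℝ → T3 → X}
    (hf : ContinuousOn (Function.uncurry f) (Icc 0 t₁ ×ˢ univ)) :
    Continuous (Function.uncurry fun s x => f (p s) x) := by
  have h : (Function.uncurry fun s x => f (p s) x) =
      Function.uncurry f ∘ fun q : ℝ × T3 => (p q.1, q.2) := by
    funext q; rfl
  rw [h]
  exact hf.comp_continuous ((hp.comp continuous_fst).prodMk continuous_snd)
    fun q => mk_mem_prod (hpm q.1) (mem_univ _)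

/-- Space derivatives of a field jointly smooth on the closed slab `[0,t₁]` are jointly continuous
on `[0,t₁] × 𝕋³` (`Torus.IsSmoothSpaceTimeOn.partialDeriv` on `Icc 0 t₁` for `t₁ > 0`; the
single smooth slice for `t₁ = 0`). [folklore] -/
theorem continuousOn_partialDeriv_slab {t₁ : ℝ} (ht : 0 ≤ t₁) {f : ℝ → T3 → ℝ}
    (hf : Torus.IsSmoothSpaceTimeOn (Icc 0 t₁) f) (k : Fin 3) :
    ContinuousOn (Function.uncurry fun s x => Torus.partialDeriv k (f s) x) (Icc 0 t₁ ×ˢ univ) := by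
  rcases ht.eq_or_lt with h0 | hpos
  · subst h0
    have hc : Continuous (Torus.partialDeriv k (f 0)) :=
      ((hf.isSmooth_slice (left_mem_Icc.2 le_rfl)).partialDeriv k).continuous
    rintro ⟨s, x⟩ hq
    have hs : s = 0 := le_antisymm (mem_prod.1 hq).1.2 (mem_prod.1 hq).1.1
    subst hs
    refine ((hc.comp continuous_snd).continuousWithinAt).congr (fun y hy => ?_) rfl
    obtain ⟨s', x'⟩ := y
    have hs' : s' = 0 := le_antisymm (mem_prod.1 hy).1.2 (mem_prod.1 hy).1.1
    subst hs'
    rfl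
  · exact Torus.continuousOn_uncurry_of_continuousOn_stLift
      ((hf.partialDeriv (uniqueDiffOn_Icc hpos) k).continuousOn_stLift)

/-- A real function jointly continuous on the compact slab `[0,t₁] × 𝕋³` is bounded there.
[folklore] -/
theorem exists_abs_le_slab {t₁ : ℝ} {f : ℝ → T3 → ℝ}
    (hf : ContinuousOn (Function.uncurry f) (Icc 0 t₁ ×ˢ univ)) :
    ∃ C : ℝ, ∀ s ∈ Icc 0 t₁, ∀ x, |f s x| ≤ C := by
  obtain ⟨C, hC⟩ := (isCompact_Icc.prod isCompact_univ).exists_bound_of_continuousOn hf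
  exact ⟨C, fun s hs x => by simpa using hC (s, x) (mk_mem_prod hs (mem_univ x))⟩

/-- A positive function jointly continuous on the compact slab `[0,t₁] × 𝕋³` (`t₁ ≥ 0`) has a
positive lower bound there. [folklore] -/
theorem exists_pos_le_slab {t₁ : ℝ} (ht : 0 ≤ t₁) {f : ℝ → T3 → ℝ}
    (hf : ContinuousOn (Function.uncurry f) (Icc 0 t₁ ×ˢ univ))
    (hpos : ∀ s ∈ Icc 0 t₁, ∀ x, 0 < f s x) :
    ∃ m : ℝ, 0 < m ∧ ∀ s ∈ Icc 0 t₁, ∀ x, m ≤ f s x := by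
  have hne : (Icc (0 : ℝ) t₁ ×ˢ (univ : Set T3)).Nonempty :=
    ⟨(0, 0), mk_mem_prod (left_mem_Icc.2 ht) (mem_univ _)⟩
  obtain ⟨⟨q₁, q₂⟩, hq, hmin⟩ := (isCompact_Icc.prod isCompact_univ).exists_isMinOn hne hf
  refine ⟨f q₁ q₂, hpos q₁ (mem_prod.1 hq).1 q₂, fun s hs x => ?_⟩
  simpa using (isMinOn_iff.1 hmin) (s, x) (mk_mem_prod hs (mem_univ x))

/-- `‖x‖ ≤ 3B` for a vector of `ℝ³` with coordinates bounded by `B`. [folklore] -/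
theorem norm_le_three_mul (x : V3) {B : ℝ} (h : ∀ k, |x k| ≤ B) : ‖x‖ ≤ 3 * B := by
  have hB : 0 ≤ B := (abs_nonneg _).trans (h 0)
  have e : ∀ k, x k ^ 2 ≤ B ^ 2 := fun k => by
    rw [← sq_abs]; exact pow_le_pow_left₀ (abs_nonneg _) (h k) 2
  have h2 : ‖x‖ ^ 2 ≤ (3 * B) ^ 2 := by
    rw [EuclideanSpace.real_norm_sq_eq, Fin.sum_univ_three]
    nlinarith [e 0, e 1, e 2]
  nlinarith [norm_nonneg x, h2]

/-! ## §3 The algebra of the traceless stress -/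

/-- The coefficient matrix `c (D_{jk} − δ_{jk} tr D/3)` is traceless. [folklore] -/
theorem trace_free (c : ℝ) (D : Fin 3 → Fin 3 → ℝ) :
    ∑ j : Fin 3, c * (D j j - if j = j then (∑ l : Fin 3, D l l) / 3 else 0) = 0 := by
  have h : ∀ j : Fin 3, c * (D j j - if j = j then (∑ l : Fin 3, D l l) / 3 else 0) =
      c * (D j j - (∑ l : Fin 3, D l l) / 3) := fun j => by rw [if_pos rfl]
  rw [Finset.sum_congr rfl fun j _ => h j]
  simp only [Fin.sum_univ_three]
  ring

/-- The LOW kinetic stress as a traceless quadratic form: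
`c Σ_{jk} (w_jw_k − δ_{jk}|w|²/3) D_{jk} = Σ_{jk} c(D_{jk} − δ_{jk} tr D/3) w_j w_k`. [folklore] -/
theorem traceless_form (c : ℝ) (w : V3) (D : Fin 3 → Fin 3 → ℝ) :
    c * ∑ j : Fin 3, ∑ k : Fin 3, (w j * w k - (if j = k then ‖w‖ ^ 2 / 3 else 0)) * D j k =
      ∑ j : Fin 3, ∑ k : Fin 3,
        (c * (D j k - if j = k then (∑ l : Fin 3, D l l) / 3 else 0)) * (w j * w k) := by
  simp only [Fin.sum_univ_three, EuclideanSpace.real_norm_sq_eq, Fin.isValue]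
  simp
  ring

end Summit.AtomisticToContinuum.HydrodynamicLimit.Theorems.ClampedCurrentsDockKineticInstance

end
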